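import Mathlib
import HarnessLib
import Literature.Analysis.FluidPDE.FluidComputerGadget
import Summits.NavierStokesRegularity.Statement

/-!
# `ns_blowup_of_gadgetLibrary` — the Clay (A) corollary of the fluid-computer interface

HONEST FRAMING: low prior, high value-of-information experiment on Tao's machine paradigm;
NOT a claim that NS blows up.

PROVER TASK (cell pub-fluidc, seat bp2 cannot write under `Theorems/`): once
`Literature/Analysis/FluidPDE/FluidComputerGadget.lean` (proposal p178206, ACCEPTED commit 68af0148772b) is in the tree, land this
file as `Summits/NavierStokesRegularity/NavierStokesRegularity/Theorems/FluidComputerGadget.lean`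
with `--supports <a negation-side item, e.g. stmt-NavierStokesRegularity-0152 BlowupExists or
stmt-NavierStokesRegularity-18302 EulerProximatePump>`. It is the summit-side one-liner: Clay (A)
applied to the library's seed contradicts `GadgetLibrary.no_global_regular_solution`.
A self-contained checked version (interface + this theorem in one file, rc 0, axioms standard) is
staged as `HOME/pub-fluidc-bp2/lean/Gadget.lean`.
-/

set_option linter.dupNamespace false -- nested layout Summit.<S>.<Sub>, Sub = S (D-0017)

namespace Summit.NavierStokesRegularity.NavierStokesRegularity.Theorems

open Literature.Analysis.FluidPDE Literature.Analysis.FluidPDE.FluidComputer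

/-- **`ns_blowup_of_gadgetLibrary`**: a gadget library for true NS (viscosity `ν > 0`) meeting
valid, closing specs above the efficiency threshold `s⁻¹ < eta` refutes Clay (A),
`NavierStokesRegularity` — Clay (A) run on the library's smooth, divergence-free, rapidly decaying
seed yields a global smooth bounded-energy solution, which
`GadgetLibrary.no_global_regular_solution` excludes. The hypotheses inside `GadgetLibrary`
(`step`, `floor`) are what Tao's averaged equation gets for free [cite: Tao2016AveragedNS, Prop 6.3]
and true NS does not. NOT a claim that NS blows up. -/
theorem ns_blowup_of_gadgetLibrary {ν : ℝ} (hν : 0 < ν) {σ : GadgetSpec} (hσ : σ.Valid)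
    (hclos : σ.Closure) (hvisc : σ.s⁻¹ < σ.eta) (lib : GadgetLibrary ν σ) :
    ¬ NavierStokesRegularity := fun hNS =>
  lib.no_global_regular_solution hσ hclos hvisc
    (hNS ν hν lib.seed lib.seed_smooth lib.seed_divFree lib.seed_decay)

/-- Exponent form: `2 < alphaEff` (the self-similar exponent beats viscosity) in place of
`s⁻¹ < eta`; see `GadgetSpec.two_lt_alphaEff_iff`. [folklore] -/
theorem ns_blowup_of_gadgetLibrary_of_alphaEff {ν : ℝ} (hν : 0 < ν) {σ : GadgetSpec}
    (hσ : σ.Valid) (hclos : σ.Closure) (hα : 2 < σ.alphaEff) (lib : GadgetLibrary ν σ) :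
    ¬ NavierStokesRegularity :=
  ns_blowup_of_gadgetLibrary hν hσ hclos
    ((GadgetSpec.two_lt_alphaEff_iff hσ.one_lt_s hσ.eta_pos).1 hα) lib

end Summit.NavierStokesRegularity.NavierStokesRegularity.Theorems
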